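import Summits.Parity.GeneralizedHardyLittlewood.Theorems.FordMaynardNoSieveConst0164NegWitness0164LinnikThree
import Literature.NumberTheory.Sieve.FordMaynardFragmentation

/-!
# Route `FordMaynardNoSieveConst0164`, crux `NegWitness0164` (stmt-Parity-19102), line `birth`,
# stub `stub_tweakNeg0164`: the Linnik weight of a four-piece fragmentation

Seventh helper file toward the certificate stub (K. Ford, J. Maynard, *On the theory of prime producing
sieves*, arXiv:2407.14368, (Linnik-fcn) §5.1 and §8, proof of Theorem 2.7 (c): "if `x ∈ 𝓗₄` with all
components `< 1/2` and no pair of components has sum equal to `1/2` then `𝓛_{1/2}(x) = 0`", and "if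
`k = 4` and `f_{5,0}(1-α,u) ≠ 0` then `𝓛_{1/2}(u) = 3`").  For a block `u = (u₀, u₁, u₂, u₃)` with all
pieces `< c` and `u₀ + u₁ + u₂ + u₃ ≥ c`, writing `N = N_{u,c}` for the indicator of the nonempty small
subvectors: `N(univ) = 0`, `N⋆N(univ) = 2T + 2Q`, `N^{⋆3}(univ) = 6P`, `N^{⋆4}(univ) = 24`, where
`P = ∑_{pairs} N`, `T = ∑_{triples} N`, `Q = ∑_{three matchings} N(p)N(p')`; hence

  `𝓛_c(u) = 0 - (2T + 2Q)/2 + 6P/3 - 24/4 = 2P - T - Q - 6`.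

On the simplex side `|u| = 2c` with no pair summing to exactly `c` this is `2·3 - 0 - 0 - 6 = 0` (the
dimension-4 part of `f(1)` vanishes almost everywhere), and when every pair is small and no triple is
small it is `12 - 0 - 3 - 6 = 3`.  These are the coefficients `blockWeight γ 4 = 𝓛_{1-γ}/(4! ∏ uᵢ)` of the
"α ↦ four pieces" terms of (6.3)/(fsl) in the certificate.  The generic convolution-square/cube values
on singletons, pairs and triples (`spow_two_*`, `spow_three_*`) are recorded for reuse in the five- and
six-piece files.  Def-free.

References: [FordMaynard2024PrimeSieves] arXiv:2407.14368, (Linnik-fcn) §5.1, §8.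
-/

noncomputable section

open Finset
open Literature.Combinatorics.Enumerative
open Literature.NumberTheory.Sieve Literature.NumberTheory.Sieve.FordMaynard

namespace Summit.Parity.GeneralizedHardyLittlewood.FordMaynardNoSieveConst0164NegWitness0164

variable {α : Type*} [DecidableEq α]

/-! ### Sums and convolutions over the subsets of a triple -/

/-- Sums over the eight subsets of a triple of distinct elements. [folklore] -/
theorem sum_powerset_triple' {a b c : α} (hab : a ≠ b) (hac : a ≠ c) (hbc : b ≠ c) (φ : Finset α → ℝ) :
    ∑ T ∈ ({a, b, c} : Finset α).powerset, φ T =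
      φ ∅ + φ {a} + φ {b} + φ {c} + φ {a, b} + φ {a, c} + φ {b, c} + φ {a, b, c} := by
  rw [Finset.sum_powerset_insert (by simp [hab, hac]), sum_powerset_pair' hbc, sum_powerset_pair' hbc,
    show insert a (∅ : Finset α) = {a} from rfl]
  ring

/-- `(F ⋆ G)` at a triple `{a, b, c}` of distinct elements, expanded over the eight subsets. [folklore] -/
theorem sconv_triple (F G : Finset α → ℝ) {a b c : α} (hab : a ≠ b) (hac : a ≠ c) (hbc : b ≠ c) :
    sconv F G {a, b, c} = F ∅ * G {a, b, c} + F {a} * G {b, c} + F {b} * G {a, c} + F {c} * G {a, b} +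
      F {a, b} * G {c} + F {a, c} * G {b} + F {b, c} * G {a} + F {a, b, c} * G ∅ := by
  unfold sconv
  rw [sum_powerset_triple' hab hac hbc]
  have e1 : ({a, b, c} : Finset α) \ {a} = {b, c} := by
    ext x; simp only [Finset.mem_sdiff, Finset.mem_insert, Finset.mem_singleton]; aesop
  have e2 : ({a, b, c} : Finset α) \ {b} = {a, c} := by
    ext x; simp only [Finset.mem_sdiff, Finset.mem_insert, Finset.mem_singleton]; aesop
  have e3 : ({a, b, c} : Finset α) \ {c} = {a, b} := by
    ext x; simp only [Finset.mem_sdiff, Finset.mem_insert, Finset.mem_singleton]; aesop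
  have e4 : ({a, b, c} : Finset α) \ {a, b} = {c} := by
    ext x; simp only [Finset.mem_sdiff, Finset.mem_insert, Finset.mem_singleton]; aesop
  have e5 : ({a, b, c} : Finset α) \ {a, c} = {b} := by
    ext x; simp only [Finset.mem_sdiff, Finset.mem_insert, Finset.mem_singleton]; aesop
  have e6 : ({a, b, c} : Finset α) \ {b, c} = {a} := by
    ext x; simp only [Finset.mem_sdiff, Finset.mem_insert, Finset.mem_singleton]; aesop
  rw [Finset.sdiff_empty, e1, e2, e3, e4, e5, e6, Finset.sdiff_self]

/-! ### Convolution squares and cubes of a set function vanishing at `∅` on small sets -/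

/-- `F⋆F({a}) = 0` when `F ∅ = 0`. [folklore] -/
theorem spow_two_singleton {F : Finset α → ℝ} (h0 : F ∅ = 0) (a : α) : spow F 2 {a} = 0 := by
  rw [spow_succ, spow_succ, spow_zero, sconv_sdelta, sconv_singleton, h0]; ring

/-- `F⋆F({a, b}) = 2` when `F ∅ = 0` and `F {a} = F {b} = 1` (`a ≠ b`). [folklore] -/
theorem spow_two_pair {F : Finset α → ℝ} (h0 : F ∅ = 0) {a b : α} (hab : a ≠ b) (ha : F {a} = 1)
    (hb : F {b} = 1) : spow F 2 {a, b} = 2 := by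
  rw [spow_succ, spow_succ, spow_zero, sconv_sdelta, sconv_pair F F hab, h0, ha, hb]; ring

/-- `F⋆F({a, b, c}) = 2 (F{a,b} + F{a,c} + F{b,c})` when `F ∅ = 0` and `F = 1` on the three singletons
(`a, b, c` distinct). [folklore] -/
theorem spow_two_triple {F : Finset α → ℝ} (h0 : F ∅ = 0) {a b c : α} (hab : a ≠ b) (hac : a ≠ c)
    (hbc : b ≠ c) (ha : F {a} = 1) (hb : F {b} = 1) (hc : F {c} = 1) :
    spow F 2 {a, b, c} = 2 * (F {a, b} + F {a, c} + F {b, c}) := by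
  rw [spow_succ, spow_succ, spow_zero, sconv_sdelta, sconv_triple F F hab hac hbc, h0, ha, hb, hc]; ring

/-- `F^{⋆3}({a}) = 0` when `F ∅ = 0`. [folklore] -/
theorem spow_three_singleton {F : Finset α → ℝ} (h0 : F ∅ = 0) (a : α) : spow F 3 {a} = 0 := by
  rw [spow_succ, sconv_singleton, h0, spow_succ_empty h0]; ring

/-- `F^{⋆3}({a, b}) = 0` when `F ∅ = 0` (`a ≠ b`): a pair has no decomposition into three nonempty
parts. [folklore] -/
theorem spow_three_pair {F : Finset α → ℝ} (h0 : F ∅ = 0) {a b : α} (hab : a ≠ b) :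
    spow F 3 {a, b} = 0 := by
  rw [spow_succ, sconv_pair F _ hab, h0, spow_two_singleton h0, spow_two_singleton h0,
    spow_succ_empty h0]; ring

/-- `F^{⋆3}({a, b, c}) = 6 = 3!` when `F ∅ = 0` and `F = 1` on the three singletons (`a, b, c`
distinct). [folklore] -/
theorem spow_three_triple {F : Finset α → ℝ} (h0 : F ∅ = 0) {a b c : α} (hab : a ≠ b) (hac : a ≠ c)
    (hbc : b ≠ c) (ha : F {a} = 1) (hb : F {b} = 1) (hc : F {c} = 1) :
    spow F 3 {a, b, c} = 6 := by
  rw [spow_succ, sconv_triple F _ hab hac hbc, h0, ha, hb, hc, spow_two_pair h0 hbc hb hc,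
    spow_two_pair h0 hac ha hc, spow_two_pair h0 hab ha hb, spow_two_singleton h0,
    spow_two_singleton h0, spow_two_singleton h0, spow_succ_empty h0]
  ring

/-! ### The sixteen subsets of `Fin 4` -/

/-- The power set of `univ : Finset (Fin 4)`. [folklore] -/
theorem powerset_univ_fin_four : (Finset.univ : Finset (Fin 4)).powerset =
    {∅, {0}, {1}, {2}, {3}, {0, 1}, {0, 2}, {0, 3}, {1, 2}, {1, 3}, {2, 3},
      {0, 1, 2}, {0, 1, 3}, {0, 2, 3}, {1, 2, 3}, Finset.univ} := by
  decide

/-- Sums over the three elements of a triple of distinct elements. [folklore] -/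
theorem sum_triple' {a b c : α} (hab : a ≠ b) (hac : a ≠ c) (hbc : b ≠ c) (f : α → ℝ) :
    ∑ i ∈ ({a, b, c} : Finset α), f i = f a + f b + f c := by
  rw [Finset.sum_insert (by simp [hab, hac]), Finset.sum_pair hbc]; ring

/-- Disjoint-union convolution on `Fin 4` at `univ`, expanded over the sixteen subsets. [folklore] -/
theorem sconv_univ_fin_four (F G : Finset (Fin 4) → ℝ) :
    sconv F G Finset.univ =
      F ∅ * G Finset.univ + F {0} * G {1, 2, 3} + F {1} * G {0, 2, 3} + F {2} * G {0, 1, 3} +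
        F {3} * G {0, 1, 2} + F {0, 1} * G {2, 3} + F {0, 2} * G {1, 3} + F {0, 3} * G {1, 2} +
        F {1, 2} * G {0, 3} + F {1, 3} * G {0, 2} + F {2, 3} * G {0, 1} + F {0, 1, 2} * G {3} +
        F {0, 1, 3} * G {2} + F {0, 2, 3} * G {1} + F {1, 2, 3} * G {0} + F Finset.univ * G ∅ := by
  unfold sconv
  rw [powerset_univ_fin_four]
  repeat rw [Finset.sum_insert (by decide)]
  rw [Finset.sum_singleton]
  have e0 : (Finset.univ : Finset (Fin 4)) \ ∅ = Finset.univ := by decide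
  have e1 : (Finset.univ : Finset (Fin 4)) \ {0} = {1, 2, 3} := by decide
  have e2 : (Finset.univ : Finset (Fin 4)) \ {1} = {0, 2, 3} := by decide
  have e3 : (Finset.univ : Finset (Fin 4)) \ {2} = {0, 1, 3} := by decide
  have e4 : (Finset.univ : Finset (Fin 4)) \ {3} = {0, 1, 2} := by decide
  have e5 : (Finset.univ : Finset (Fin 4)) \ {0, 1} = {2, 3} := by decide
  have e6 : (Finset.univ : Finset (Fin 4)) \ {0, 2} = {1, 3} := by decide
  have e7 : (Finset.univ : Finset (Fin 4)) \ {0, 3} = {1, 2} := by decide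
  have e8 : (Finset.univ : Finset (Fin 4)) \ {1, 2} = {0, 3} := by decide
  have e9 : (Finset.univ : Finset (Fin 4)) \ {1, 3} = {0, 2} := by decide
  have e10 : (Finset.univ : Finset (Fin 4)) \ {2, 3} = {0, 1} := by decide
  have e11 : (Finset.univ : Finset (Fin 4)) \ {0, 1, 2} = {3} := by decide
  have e12 : (Finset.univ : Finset (Fin 4)) \ {0, 1, 3} = {2} := by decide
  have e13 : (Finset.univ : Finset (Fin 4)) \ {0, 2, 3} = {1} := by decide
  have e14 : (Finset.univ : Finset (Fin 4)) \ {1, 2, 3} = {0} := by decide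
  have e15 : (Finset.univ : Finset (Fin 4)) \ Finset.univ = ∅ := by decide
  rw [e0, e1, e2, e3, e4, e5, e6, e7, e8, e9, e10, e11, e12, e13, e14, e15]
  ring

/-! ### The Linnik function of a four-piece block -/

/-- **`𝓛_c(u₀,u₁,u₂,u₃) = 2P - T - Q - 6`** for a four-piece block with all pieces `< c` and total `≥ c`,
where, with `N = N_{u,c}` (`smallFn`), `P = ∑_{pairs} N`, `T = ∑_{triples} N` and
`Q = N{0,1}N{2,3} + N{0,2}N{1,3} + N{0,3}N{1,2}`: the convolution powers at `univ` are
`N = 0`, `N⋆N = 2T + 2Q`, `N^{⋆3} = 6P`, `N^{⋆4} = 24`.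
[cite: FordMaynard2024PrimeSieves, (Linnik-fcn) §5.1 and §8 (proof of Theorem 2.7 (c), the cases k = 4)] -/
theorem linnikFn_four_eq {c : ℝ} (u : Fin 4 → ℝ) (hlt : ∀ i, u i < c)
    (hs : c ≤ u 0 + u 1 + u 2 + u 3) :
    linnikFn c u Finset.univ =
      2 * (smallFn c u {0, 1} + smallFn c u {0, 2} + smallFn c u {0, 3} + smallFn c u {1, 2} +
          smallFn c u {1, 3} + smallFn c u {2, 3}) -
        (smallFn c u {0, 1, 2} + smallFn c u {0, 1, 3} + smallFn c u {0, 2, 3} + smallFn c u {1, 2, 3}) -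
        (smallFn c u {0, 1} * smallFn c u {2, 3} + smallFn c u {0, 2} * smallFn c u {1, 3} +
          smallFn c u {0, 3} * smallFn c u {1, 2}) - 6 := by
  set N := smallFn c u with hN
  have hNe : N ∅ = 0 := smallFn_empty c u
  have hNs : ∀ i : Fin 4, N {i} = 1 := fun i =>
    smallFn_eq_one (Finset.singleton_nonempty i) (by simpa using hlt i)
  have hNu : N Finset.univ = 0 :=
    smallFn_eq_zero (by simpa [Fin.sum_univ_four, add_assoc] using hs)
  have h01 : (0 : Fin 4) ≠ 1 := by decide
  have h02 : (0 : Fin 4) ≠ 2 := by decide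
  have h03 : (0 : Fin 4) ≠ 3 := by decide
  have h12 : (1 : Fin 4) ≠ 2 := by decide
  have h13 : (1 : Fin 4) ≠ 3 := by decide
  have h23 : (2 : Fin 4) ≠ 3 := by decide
  -- the four convolution powers at `univ`
  have hp1 : spow N 1 Finset.univ = 0 := by
    rw [spow_succ, spow_zero, sconv_sdelta, hNu]
  have hp2 : spow N 2 Finset.univ =
      2 * (N {0, 1, 2} + N {0, 1, 3} + N {0, 2, 3} + N {1, 2, 3}) +
        2 * (N {0, 1} * N {2, 3} + N {0, 2} * N {1, 3} + N {0, 3} * N {1, 2}) := by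
    rw [spow_succ, spow_succ, spow_zero, sconv_sdelta, sconv_univ_fin_four, hNe, hNu, hNs, hNs, hNs, hNs]
    ring
  have hp3 : spow N 3 Finset.univ =
      6 * (N {0, 1} + N {0, 2} + N {0, 3} + N {1, 2} + N {1, 3} + N {2, 3}) := by
    rw [spow_succ, sconv_univ_fin_four, hNe, hNu, hNs, hNs, hNs, hNs,
      spow_two_triple hNe h12 h13 h23 (hNs 1) (hNs 2) (hNs 3),
      spow_two_triple hNe h02 h03 h23 (hNs 0) (hNs 2) (hNs 3),
      spow_two_triple hNe h01 h03 h13 (hNs 0) (hNs 1) (hNs 3),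
      spow_two_triple hNe h01 h02 h12 (hNs 0) (hNs 1) (hNs 2),
      spow_two_pair hNe h23 (hNs 2) (hNs 3), spow_two_pair hNe h13 (hNs 1) (hNs 3),
      spow_two_pair hNe h12 (hNs 1) (hNs 2), spow_two_pair hNe h03 (hNs 0) (hNs 3),
      spow_two_pair hNe h02 (hNs 0) (hNs 2), spow_two_pair hNe h01 (hNs 0) (hNs 1),
      spow_two_singleton hNe, spow_two_singleton hNe, spow_two_singleton hNe, spow_two_singleton hNe,
      spow_succ_empty hNe]
    ring
  have hp4 : spow N 4 Finset.univ = 24 := by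
    rw [spow_succ, sconv_univ_fin_four, hNe, hNu,
      spow_three_triple hNe h12 h13 h23 (hNs 1) (hNs 2) (hNs 3),
      spow_three_triple hNe h02 h03 h23 (hNs 0) (hNs 2) (hNs 3),
      spow_three_triple hNe h01 h03 h13 (hNs 0) (hNs 1) (hNs 3),
      spow_three_triple hNe h01 h02 h12 (hNs 0) (hNs 1) (hNs 2),
      spow_three_pair hNe h23, spow_three_pair hNe h13, spow_three_pair hNe h12, spow_three_pair hNe h03,
      spow_three_pair hNe h02, spow_three_pair hNe h01,
      spow_three_singleton hNe, spow_three_singleton hNe, spow_three_singleton hNe,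
      spow_three_singleton hNe, spow_succ_empty hNe, hNs, hNs, hNs, hNs]
    ring
  unfold linnikFn
  rw [Fintype.card_fin, show Finset.Icc 1 4 = {1, 2, 3, 4} from by decide,
    Finset.sum_insert (by decide), Finset.sum_insert (by decide), Finset.sum_pair (by norm_num), ← hN,
    hp1, hp2, hp3, hp4]
  simp only [wLinnik]
  norm_num
  ring

/-- **`𝓛_c(u) = 0` on the simplex side**: for a four-piece block with all pieces `< c`, total `2c` and
no pair summing to exactly `c`, each of the three matchings has exactly one small pair (`P = 3`,
`Q = 0`) and no triple is small (`T = 0`), so `𝓛_c(u) = 6 - 0 - 0 - 6 = 0` — with `c = 1/2`: the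
Linnik weight of `x ∈ 𝓗₄` (`|x| = 1`, all `xᵢ < 1/2`) vanishes off the null set `{xᵢ + xⱼ = 1/2}`, so
the dimension-4 part of `f(1)` in (6.3) is zero.
[cite: FordMaynard2024PrimeSieves, §8 (proof of Theorem 2.7 (c): "if x ∈ 𝓗₄ … then 𝓛_{1/2}(x) = 0")] -/
theorem linnikFn_four_eq_zero {c : ℝ} (u : Fin 4 → ℝ) (hlt : ∀ i, u i < c)
    (hsum : u 0 + u 1 + u 2 + u 3 = 2 * c) (h01 : u 0 + u 1 ≠ c) (h02 : u 0 + u 2 ≠ c)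
    (h03 : u 0 + u 3 ≠ c) : linnikFn c u Finset.univ = 0 := by
  have i01 : (0 : Fin 4) ≠ 1 := by decide
  have i02 : (0 : Fin 4) ≠ 2 := by decide
  have i03 : (0 : Fin 4) ≠ 3 := by decide
  have i12 : (1 : Fin 4) ≠ 2 := by decide
  have i13 : (1 : Fin 4) ≠ 3 := by decide
  have i23 : (2 : Fin 4) ≠ 3 := by decide
  rw [linnikFn_four_eq u hlt (by linarith [hlt 0, hlt 1, hlt 2, hlt 3])]
  -- no triple is small
  have t012 : smallFn c u {0, 1, 2} = 0 :=
    smallFn_eq_zero (by rw [sum_triple' i01 i02 i12]; linarith [hlt 3])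
  have t013 : smallFn c u {0, 1, 3} = 0 :=
    smallFn_eq_zero (by rw [sum_triple' i01 i03 i13]; linarith [hlt 2])
  have t023 : smallFn c u {0, 2, 3} = 0 :=
    smallFn_eq_zero (by rw [sum_triple' i02 i03 i23]; linarith [hlt 1])
  have t123 : smallFn c u {1, 2, 3} = 0 :=
    smallFn_eq_zero (by rw [sum_triple' i12 i13 i23]; linarith [hlt 0])
  -- each matching has exactly one small pair
  have m1 : smallFn c u {0, 1} + smallFn c u {2, 3} = 1 ∧ smallFn c u {0, 1} * smallFn c u {2, 3} = 0 := by
    rcases lt_or_gt_of_ne h01 with h | h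
    · rw [smallFn_eq_one (Finset.insert_nonempty _ _) (by rwa [Finset.sum_pair i01]),
        smallFn_eq_zero (by rw [Finset.sum_pair i23]; linarith)]
      norm_num
    · rw [smallFn_eq_zero (by rw [Finset.sum_pair i01]; exact le_of_lt h),
        smallFn_eq_one (Finset.insert_nonempty _ _) (by rw [Finset.sum_pair i23]; linarith)]
      norm_num
  have m2 : smallFn c u {0, 2} + smallFn c u {1, 3} = 1 ∧ smallFn c u {0, 2} * smallFn c u {1, 3} = 0 := by
    rcases lt_or_gt_of_ne h02 with h | h
    · rw [smallFn_eq_one (Finset.insert_nonempty _ _) (by rwa [Finset.sum_pair i02]),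
        smallFn_eq_zero (by rw [Finset.sum_pair i13]; linarith)]
      norm_num
    · rw [smallFn_eq_zero (by rw [Finset.sum_pair i02]; exact le_of_lt h),
        smallFn_eq_one (Finset.insert_nonempty _ _) (by rw [Finset.sum_pair i13]; linarith)]
      norm_num
  have m3 : smallFn c u {0, 3} + smallFn c u {1, 2} = 1 ∧ smallFn c u {0, 3} * smallFn c u {1, 2} = 0 := by
    rcases lt_or_gt_of_ne h03 with h | h
    · rw [smallFn_eq_one (Finset.insert_nonempty _ _) (by rwa [Finset.sum_pair i03]),
        smallFn_eq_zero (by rw [Finset.sum_pair i12]; linarith)]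
      norm_num
    · rw [smallFn_eq_zero (by rw [Finset.sum_pair i03]; exact le_of_lt h),
        smallFn_eq_one (Finset.insert_nonempty _ _) (by rw [Finset.sum_pair i12]; linarith)]
      norm_num
  rw [t012, t013, t023, t123]
  linarith [m1.1, m1.2, m2.1, m2.2, m3.1, m3.2]

/-- **`𝓛_c(u) = 3`** for a four-piece block with every pair of pieces summing to `< c` and every triple
summing to `≥ c` (`P = 6`, `Q = 3`, `T = 0`): `12 - 0 - 3 - 6 = 3` — the weight of the four-piece
fragmentations `u` of `α` meeting the support of Ford–Maynard's `f_{5,0}`.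
[cite: FordMaynard2024PrimeSieves, §8 (proof of Theorem 2.7 (c): "if k = 4 and f_{5,0}(1-α,u) ≠ 0 then 𝓛_{1/2}(u) = 3")] -/
theorem linnikFn_four_eq_three {c : ℝ} (u : Fin 4 → ℝ)
    (hp : ∀ i j : Fin 4, i ≠ j → u i + u j < c)
    (ht : ∀ i j k : Fin 4, i ≠ j → i ≠ k → j ≠ k → c ≤ u i + u j + u k) :
    linnikFn c u Finset.univ = 3 := by
  have i01 : (0 : Fin 4) ≠ 1 := by decide
  have i02 : (0 : Fin 4) ≠ 2 := by decide
  have i03 : (0 : Fin 4) ≠ 3 := by decide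
  have i12 : (1 : Fin 4) ≠ 2 := by decide
  have i13 : (1 : Fin 4) ≠ 3 := by decide
  have i23 : (2 : Fin 4) ≠ 3 := by decide
  -- every piece is positive (`uⱼ = (uᵢ + uⱼ + uₖ) - (uᵢ + uₖ) > c - c`) and hence `< c`
  have p0 : 0 < u 0 := by linarith [hp 1 2 i12, ht 0 1 2 i01 i02 i12]
  have p1 : 0 < u 1 := by linarith [hp 0 2 i02, ht 0 1 2 i01 i02 i12]
  have p2 : 0 < u 2 := by linarith [hp 0 1 i01, ht 0 1 2 i01 i02 i12]
  have p3 : 0 < u 3 := by linarith [hp 0 1 i01, ht 0 1 3 i01 i03 i13]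
  have hlt : ∀ i, u i < c := by
    intro i
    fin_cases i
    · show u 0 < c; linarith [hp 0 1 i01]
    · show u 1 < c; linarith [hp 0 1 i01]
    · show u 2 < c; linarith [hp 0 2 i02]
    · show u 3 < c; linarith [hp 0 3 i03]
  rw [linnikFn_four_eq u hlt (by linarith [ht 0 1 2 i01 i02 i12])]
  have pr : ∀ i j : Fin 4, i ≠ j → smallFn c u {i, j} = 1 := fun i j hij =>
    smallFn_eq_one (Finset.insert_nonempty _ _) (by rw [Finset.sum_pair hij]; exact hp i j hij)
  have tr : ∀ i j k : Fin 4, i ≠ j → i ≠ k → j ≠ k → smallFn c u {i, j, k} = 0 := fun i j k hij hik hjk =>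
    smallFn_eq_zero (by rw [sum_triple' hij hik hjk]; exact ht i j k hij hik hjk)
  rw [pr 0 1 i01, pr 0 2 i02, pr 0 3 i03, pr 1 2 i12, pr 1 3 i13, pr 2 3 i23,
    tr 0 1 2 i01 i02 i12, tr 0 1 3 i01 i03 i13, tr 0 2 3 i02 i03 i23, tr 1 2 3 i12 i13 i23]
  norm_num

/-! ### The weights of four-piece fragmentations -/

/-- **The weight of a four-piece fragmentation on the simplex side vanishes**: for `u₀,…,u₃ < 1 - γ`
with total `2(1 - γ)` and no pair summing to exactly `1 - γ`, `blockWeight γ 4 u = 0`.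
[cite: FordMaynard2024PrimeSieves, §6.1 (6.3) and §8] -/
theorem blockWeight_four_eq_zero {γ : ℝ} (u : Fin 4 → ℝ) (hlt : ∀ i, u i < 1 - γ)
    (hsum : u 0 + u 1 + u 2 + u 3 = 2 * (1 - γ)) (h01 : u 0 + u 1 ≠ 1 - γ) (h02 : u 0 + u 2 ≠ 1 - γ)
    (h03 : u 0 + u 3 ≠ 1 - γ) : blockWeight γ 4 u = 0 := by
  unfold blockWeight
  rw [linnikFn_four_eq_zero u hlt hsum h01 h02 h03, zero_div]

/-- **The weight of a four-piece fragmentation with all pairs small and no small triple**: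
`blockWeight γ 4 u = 3/(4! u₀u₁u₂u₃) = 1/(8 u₀u₁u₂u₃)`.
[cite: FordMaynard2024PrimeSieves, §6.1 (6.3) and §8] -/
theorem blockWeight_four_eq {γ : ℝ} (u : Fin 4 → ℝ)
    (hp : ∀ i j : Fin 4, i ≠ j → u i + u j < 1 - γ)
    (ht : ∀ i j k : Fin 4, i ≠ j → i ≠ k → j ≠ k → 1 - γ ≤ u i + u j + u k) :
    blockWeight γ 4 u = 1 / (8 * (u 0 * u 1 * u 2 * u 3)) := by
  unfold blockWeight
  rw [linnikFn_four_eq_three u hp ht, Fin.prod_univ_four,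
    show (Nat.factorial 4 : ℝ) = 24 from by norm_num [Nat.factorial]]
  by_cases h : u 0 * u 1 * u 2 * u 3 = 0
  · rw [h, mul_zero, mul_zero, div_zero, div_zero]
  · field_simp
    norm_num

end Summit.Parity.GeneralizedHardyLittlewood.FordMaynardNoSieveConst0164NegWitness0164

end
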